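import Mathlib
import Literature.Analysis.FluidPDE.ClassicalSolution
import Literature.Analysis.FluidPDE.RapidDecayLemmas
import Literature.Analysis.FluidPDE.WholeSpaceIBP
import Literature.Analysis.FluidPDE.SpaceTimeCalculus
import Literature.Analysis.FluidPDE.MildSolutionProofs
import Literature.Analysis.FluidPDE.PineauVicolWeightPositivity
import Literature.Analysis.FluidPDE.LerayProfileCalculus
import Literature.Analysis.FluidPDE.HessianLaplacian
import Summits.NavierStokesRegularity.NavierStokesRegularity.Theorems.AdaptedFrequencyAdaptedFrequencyConvergesStubKernelCalculusIBP
import HarnessLib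

/-!
# Kato's `L¹` mass inequality for adjoint test fields — slice tools
(crux stmt-NavierStokesRegularity-1589 `RecurrentProfiles.RecurrentLiouville`, line `Sketch`
(ideator-4 `flux-weighted-stretching-clock`), helper file for the registered stub `stub_clockAdjointMass`)

For a `C²` vector field `w : ℝ³ → ℝ³` and `δ > 0` let `ρ_δ(w) = √(‖w‖² + δ²)` (the tree's
`PineauVicol2026.absApprox δ ‖w‖`, a smooth convex regularisation of `‖w‖`). This file proves the
pointwise calculus of `ρ_δ(w)` — `D ρ_δ(w) v = ⟪w, Dw v⟫/ρ_δ(w)` and **Kato's inequality**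
`⟪w, Δw⟫/ρ_δ(w) ≤ Δ ρ_δ(w)` (from `Δρ² = 2ρΔρ + 2|∇ρ|²`, `Δ‖w‖² = 2⟪Δw, w⟫ + 2|Dw|²_F` and the
Cauchy–Schwarz bound `|∂ᵢρ| ≤ ‖∂ᵢw‖`) — and its integrated form against the tree's cut-off
`χ_R = cutoff R`: for a bounded divergence-free `C¹` drift `β` (`‖β‖ ≤ B`) and a nonnegative
majorant `Λ` of the strain form of `β` (`⟪Dβ ξ, ξ⟫ ≤ Λ ‖ξ‖²`),
`∫ ⟪w, −(Δw + Dw β + (Dβ)ᵀ w)⟫/ρ_δ(w) · χ_R ≥ −((B C₁ + C₂)/R) ∫‖w‖ − ∫ Λ‖w‖`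
(`clockMass_slice_integral_ge`; two integrations by parts without boundary terms on the compact
support of `χ_R`, as in the scalar Kato file `…AdaptedFrequencyConvergesStubKatoL1`). Finally the
removal of the cut-off and of the regularisation, `∫ (ρ_{1/(n+1)}(w) − 1/(n+1)) χ_{n+1} → ∫ ‖w‖`
(dominated convergence).

## References

* T. Kato, Israel J. Math. 13 (1972) 135–148 (Kato's inequality `Δ|u| ≥ Re(sgn ū Δu)`).
* P. Constantin, Comm. Math. Phys. 129 (1990) 241–266, §2 (2.9). [Constantin1990]
-/

noncomputable section

-- the sub-problem namespace repeats the summit name (D-0017 layout `Summit.<S>.<P>.Theorems`)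
set_option linter.dupNamespace false

namespace Summit.NavierStokesRegularity.NavierStokesRegularity.Theorems

open MeasureTheory Set Function Filter Topology TopologicalSpace Metric
open Literature.Analysis Literature.Analysis.FluidPDE
open Literature.Analysis.FluidPDE.PineauVicol2026
open Summit.NavierStokesRegularity.NavierStokesRegularity.Theorems.AdaptedFrequencyConverges.TauberianOmegaLimit
open scoped NNReal ENNReal RealInnerProductSpace Laplacian

/-! ### Pointwise calculus of `ρ_δ(w) = √(‖w‖² + δ²)` -/

section Pointwise

variable {w : EuclideanSpace ℝ (Fin 3) → EuclideanSpace ℝ (Fin 3)} {δ : ℝ}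
  {x : EuclideanSpace ℝ (Fin 3)}

/-- `ρ_δ(w) = √(‖w‖² + δ²)` is `Cⁿ` for a `Cⁿ` field `w` and `δ > 0`. [folklore] -/
theorem clockMass_contDiff_rho {n : WithTop ℕ∞} (hw : ContDiff ℝ n w) (hδ : 0 < δ) :
    ContDiff ℝ n fun y => absApprox δ ‖w y‖ := by
  unfold absApprox
  exact ((hw.norm_sq ℝ).add contDiff_const).sqrt fun y => (absApprox_arg_pos hδ ‖w y‖).ne'

/-- `‖w‖ ≤ ρ_δ(w)`. [folklore] -/
theorem clockMass_norm_le_rho (w : EuclideanSpace ℝ (Fin 3) → EuclideanSpace ℝ (Fin 3)) (δ : ℝ)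
    (y : EuclideanSpace ℝ (Fin 3)) : ‖w y‖ ≤ absApprox δ ‖w y‖ :=
  (le_abs_self _).trans (abs_le_absApprox _)

/-- `|ρ_δ(w) − δ| ≤ ‖w‖` (`δ ≤ ρ_δ ≤ ‖w‖ + δ`). [folklore] -/
theorem clockMass_abs_rho_sub_le (hδ : 0 < δ) (w : EuclideanSpace ℝ (Fin 3) → EuclideanSpace ℝ (Fin 3))
    (y : EuclideanSpace ℝ (Fin 3)) : |absApprox δ ‖w y‖ - δ| ≤ ‖w y‖ := by
  rw [abs_le]
  constructor
  · linarith [le_absApprox hδ ‖w y‖, norm_nonneg (w y)]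
  · have := absApprox_le hδ ‖w y‖
    rw [abs_norm] at this
    linarith

/-- The chain rule for `ρ_δ(w)`: `D ρ_δ(w)(x) v = ⟪w x, Dw(x) v⟫ / ρ_δ(w x)`. [folklore] -/
theorem clockMass_fderiv_rho_apply (hw : DifferentiableAt ℝ w x) (hδ : 0 < δ)
    (v : EuclideanSpace ℝ (Fin 3)) :
    fderiv ℝ (fun y => absApprox δ ‖w y‖) x v = ⟪w x, fderiv ℝ w x v⟫ / absApprox δ ‖w x‖ := by
  have h1 : HasFDerivAt (fun y => ‖w y‖ ^ 2 + δ ^ 2)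
      ((2 : ℕ) • (innerSL ℝ (w x)).comp (fderiv ℝ w x)) x :=
    hw.hasFDerivAt.norm_sq.add_const (δ ^ 2)
  have h2 := h1.sqrt (absApprox_arg_pos hδ ‖w x‖).ne'
  unfold absApprox
  rw [h2.fderiv, smul_apply, smul_apply, ContinuousLinearMap.comp_apply, innerSL_apply_apply,
    nsmul_eq_mul, smul_eq_mul]
  have hpos : 0 < Real.sqrt (‖w x‖ ^ 2 + δ ^ 2) := absApprox_pos hδ ‖w x‖
  field_simp
  ring

/-- **Kato's inequality for a vector field, pointwise**: `⟪w, Δw⟫ / ρ_δ(w) ≤ Δ ρ_δ(w)` for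
`w ∈ C²`, `δ > 0` (`ρΔρ = ⟪Δw, w⟫ + |Dw|²_F − |∇ρ|²` and `|∂ᵢρ| = |⟪w, ∂ᵢw⟫|/ρ ≤ ‖∂ᵢw‖`).
[cite: Constantin1990, (2.9)] -/
theorem clockMass_kato_pointwise (hw : ContDiff ℝ 2 w) (hδ : 0 < δ) (x : EuclideanSpace ℝ (Fin 3)) :
    ⟪w x, (Δ w) x⟫ / absApprox δ ‖w x‖ ≤ (Δ (fun y => absApprox δ ‖w y‖)) x := by
  set b := stdOrthonormalBasis ℝ (EuclideanSpace ℝ (Fin 3)) with hb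
  obtain ⟨ρ, hρdef⟩ : ∃ ρ : EuclideanSpace ℝ (Fin 3) → ℝ, ρ = fun y => absApprox δ ‖w y‖ :=
    ⟨_, rfl⟩
  have hρ2 : ContDiff ℝ 2 ρ := hρdef ▸ clockMass_contDiff_rho hw hδ
  have hρpos : ∀ y, 0 < ρ y := fun y => by rw [hρdef]; exact absApprox_pos hδ _
  have hwd : ∀ y, DifferentiableAt ℝ w y := fun y => hw.differentiable two_ne_zero y
  -- `Δ(ρ²)` two ways
  have h1 : (Δ fun y => ρ y * ρ y) x =
      ρ x * (Δ ρ) x + ρ x * (Δ ρ) x + 2 * ∑ i, fderiv ℝ ρ x (b i) * fderiv ℝ ρ x (b i) :=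
    laplacian_mul_eq b hρ2 hρ2 x
  have h2 : (Δ fun y => ρ y * ρ y) x = 2 * ⟪(Δ w) x, w x⟫ + 2 * ∑ i, ‖fderiv ℝ w x (b i)‖ ^ 2 := by
    have e : (fun y => ρ y * ρ y) = (fun y => ⟪w y, w y⟫) + fun _ => δ ^ 2 := by
      funext y
      simp only [Pi.add_apply]
      rw [← sq, hρdef, absApprox_sq hδ, real_inner_self_eq_norm_sq]
    rw [e, ContDiffAt.laplacian_add (hw.inner ℝ hw).contDiffAt contDiffAt_const,
      laplacian_inner_self_eq hw x, InnerProductSpace.laplacian_const, frobeniusNormSq_eq_sum b]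
    simp
  -- `|∂ᵢρ|² ≤ ‖∂ᵢw‖²`
  have h3 : ∀ i, fderiv ℝ ρ x (b i) * fderiv ℝ ρ x (b i) ≤ ‖fderiv ℝ w x (b i)‖ ^ 2 := by
    intro i
    have hρx := hρpos x
    have hwle : ‖w x‖ ≤ ρ x := by rw [hρdef]; exact clockMass_norm_le_rho w δ x
    have hD : fderiv ℝ ρ x (b i) = ⟪w x, fderiv ℝ w x (b i)⟫ / ρ x := by
      rw [hρdef]; exact clockMass_fderiv_rho_apply (hwd x) hδ (b i)
    rw [hD, div_mul_div_comm, div_le_iff₀ (mul_pos hρx hρx)]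
    have hcs : |⟪w x, fderiv ℝ w x (b i)⟫| ≤ ‖w x‖ * ‖fderiv ℝ w x (b i)‖ :=
      abs_real_inner_le_norm _ _
    have h4 : |⟪w x, fderiv ℝ w x (b i)⟫| ≤ ρ x * ‖fderiv ℝ w x (b i)‖ :=
      hcs.trans (mul_le_mul_of_nonneg_right hwle (norm_nonneg _))
    have h5 : |⟪w x, fderiv ℝ w x (b i)⟫| ^ 2 ≤ (ρ x * ‖fderiv ℝ w x (b i)‖) ^ 2 :=
      pow_le_pow_left₀ (abs_nonneg _) h4 2
    rw [sq_abs] at h5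
    nlinarith [h5]
  have h6 : ∑ i, fderiv ℝ ρ x (b i) * fderiv ℝ ρ x (b i) ≤ ∑ i, ‖fderiv ℝ w x (b i)‖ ^ 2 :=
    Finset.sum_le_sum fun i _ => h3 i
  have h7 : ⟪w x, (Δ w) x⟫ ≤ ρ x * (Δ ρ) x := by
    rw [real_inner_comm]
    linarith
  have e : absApprox δ ‖w x‖ = ρ x := by rw [hρdef]
  rw [← hρdef, e, div_le_iff₀ (hρpos x)]
  linarith

end Pointwise

/-! ### Kato's inequality on a slice, integrated against a cut-off -/

section Slice

/-- Continuity of `x ↦ (Dβ(x))ᵀ (w x)` for `β ∈ C¹` and `w` continuous. [folklore] -/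
theorem clockMass_continuous_adjoint_apply {w β : EuclideanSpace ℝ (Fin 3) → EuclideanSpace ℝ (Fin 3)}
    (hw : Continuous w) (hβ : ContDiff ℝ 1 β) :
    Continuous fun x => ContinuousLinearMap.adjoint (fderiv ℝ β x) (w x) := by
  have h1 : Continuous fun x => ContinuousLinearMap.adjoint (fderiv ℝ β x) :=
    (ContinuousLinearMap.adjoint :
      (EuclideanSpace ℝ (Fin 3) →L[ℝ] EuclideanSpace ℝ (Fin 3)) ≃ₗᵢ⋆[ℝ]
        (EuclideanSpace ℝ (Fin 3) →L[ℝ] EuclideanSpace ℝ (Fin 3))).continuous.comp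
      (hβ.continuous_fderiv one_ne_zero)
  exact h1.clm_apply hw

/-- **Kato's inequality on a slice, integrated against a cut-off, with a stretching majorant.**
For `w ∈ C²` integrable, a divergence-free `C¹` drift `β` with `‖β‖ ≤ B`, a nonnegative `Λ` with
`⟪Dβ ξ, ξ⟫ ≤ Λ ‖ξ‖²` and `Λ‖w‖` integrable, `δ > 0`, `R ≥ 1` and the cut-off bounds
`‖Dχ_R‖ ≤ C₁/R`, `|Δχ_R| ≤ C₂/R²`:
`∫ ⟪w, −(Δw + Dw β + (Dβ)ᵀw)⟫/ρ_δ(w) χ_R ≥ −((B C₁ + C₂)/R) ∫ ‖w‖ − ∫ Λ‖w‖`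
(pointwise Kato, `⟪w, Dw β⟫/ρ = Dρ β`, `⟪w, (Dβ)ᵀw⟫ = ⟪Dβ w, w⟫ ≤ Λ‖w‖² ≤ Λ‖w‖ρ`, and two
integrations by parts without boundary terms). [cite: Constantin1990, (2.9)] -/
theorem clockMass_slice_integral_ge {w β : EuclideanSpace ℝ (Fin 3) → EuclideanSpace ℝ (Fin 3)}
    {Λs : EuclideanSpace ℝ (Fin 3) → ℝ} {B δ R C₁ C₂ : ℝ}
    (hw : ContDiff ℝ 2 w) (hwi : Integrable w) (hβ : ContDiff ℝ 1 β)
    (hdiv : VectorCalculus.IsDivFree β) (hB : ∀ x, ‖β x‖ ≤ B) (hΛ0 : ∀ x, 0 ≤ Λs x)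
    (hΛ : ∀ x ξ, ⟪fderiv ℝ β x ξ, ξ⟫ ≤ Λs x * ‖ξ‖ ^ 2)
    (hΛi : Integrable fun x => Λs x * ‖w x‖) (hδ : 0 < δ) (hR : 1 ≤ R) (hC₁0 : 0 ≤ C₁)
    (hC₁ : ∀ x, ‖fderiv ℝ (cutoff R : EuclideanSpace ℝ (Fin 3) → ℝ) x‖ ≤ C₁ / R) (hC₂0 : 0 ≤ C₂)
    (hC₂ : ∀ x, |(Δ (cutoff R : EuclideanSpace ℝ (Fin 3) → ℝ)) x| ≤ C₂ / R ^ 2) :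
    -((B * C₁ + C₂) / R * ∫ x, ‖w x‖) - ∫ x, Λs x * ‖w x‖ ≤
      ∫ x, ⟪w x, -((Δ w) x + fderiv ℝ w x (β x) +
          ContinuousLinearMap.adjoint (fderiv ℝ β x) (w x))⟫ / absApprox δ ‖w x‖ * cutoff R x := by
  have hR0 : 0 < R := one_pos.trans_le hR
  obtain ⟨χ, hχdef⟩ : ∃ χ : EuclideanSpace ℝ (Fin 3) → ℝ, χ = cutoff R := ⟨_, rfl⟩
  have hχ : ContDiff ℝ 2 χ := hχdef ▸ contDiff_cutoff R
  have hχc : HasCompactSupport χ := hχdef ▸ hasCompactSupport_cutoff hR0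
  have hχ0 : ∀ x, 0 ≤ χ x := fun x => hχdef ▸ cutoff_nonneg R x
  have hχ1 : ∀ x, χ x ≤ 1 := fun x => hχdef ▸ cutoff_le_one R x
  obtain ⟨ρ, hρdef⟩ : ∃ ρ : EuclideanSpace ℝ (Fin 3) → ℝ, ρ = fun y => absApprox δ ‖w y‖ :=
    ⟨_, rfl⟩
  have hρ2 : ContDiff ℝ 2 ρ := hρdef ▸ clockMass_contDiff_rho hw hδ
  have hρpos : ∀ y, 0 < ρ y := fun y => by rw [hρdef]; exact absApprox_pos hδ _
  have hwle : ∀ y, ‖w y‖ ≤ ρ y := fun y => by rw [hρdef]; exact clockMass_norm_le_rho w δ y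
  have hwd : ∀ y, DifferentiableAt ℝ w y := fun y => hw.differentiable two_ne_zero y
  obtain ⟨g, hgdef⟩ : ∃ g : EuclideanSpace ℝ (Fin 3) → ℝ, g = fun y => ρ y - δ := ⟨_, rfl⟩
  have hg2 : ContDiff ℝ 2 g := hgdef ▸ hρ2.sub contDiff_const
  have hg_le : ∀ y, |g y| ≤ ‖w y‖ := fun y => by
    rw [hgdef, hρdef]; exact clockMass_abs_rho_sub_le hδ w y
  have hDg : ∀ y v, fderiv ℝ g y v = ⟪w y, fderiv ℝ w y v⟫ / ρ y := by
    intro y v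
    rw [hgdef, fderiv_sub_const, hρdef]
    exact clockMass_fderiv_rho_apply (hwd y) hδ v
  have hΔg : ∀ y, ⟪w y, (Δ w) y⟫ / ρ y ≤ (Δ g) y := by
    intro y
    have e1 : g = ρ - fun _ => δ := by rw [hgdef]; rfl
    rw [e1, ContDiffAt.laplacian_sub hρ2.contDiffAt contDiffAt_const,
      InnerProductSpace.laplacian_const, Pi.zero_apply, sub_zero, hρdef]
    exact clockMass_kato_pointwise hw hδ y
  -- pointwise lower bound of the integrand
  have hpt : ∀ x, -(χ x * (Δ g) x) - χ x * fderiv ℝ g x (β x) - Λs x * ‖w x‖ ≤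
      ⟪w x, -((Δ w) x + fderiv ℝ w x (β x) +
          ContinuousLinearMap.adjoint (fderiv ℝ β x) (w x))⟫ / absApprox δ ‖w x‖ * χ x := by
    intro x
    have hρx := hρpos x
    have eρ : absApprox δ ‖w x‖ = ρ x := by rw [hρdef]
    rw [eρ, inner_neg_right, inner_add_right, inner_add_right, hDg,
      ContinuousLinearMap.adjoint_inner_right]
    have hstr : ⟪fderiv ℝ β x (w x), w x⟫ / ρ x * χ x ≤ Λs x * ‖w x‖ := by
      have h1 : ⟪fderiv ℝ β x (w x), w x⟫ / ρ x * χ x ≤ Λs x * ‖w x‖ ^ 2 / ρ x * χ x := by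
        gcongr
        · exact hχ0 x
        · exact hΛ x (w x)
      have h2 : Λs x * ‖w x‖ ^ 2 / ρ x ≤ Λs x * ‖w x‖ := by
        rw [div_le_iff₀ hρx]
        have := mul_le_mul_of_nonneg_left (hwle x) (mul_nonneg (hΛ0 x) (norm_nonneg (w x)))
        nlinarith [this]
      have h3 : 0 ≤ Λs x * ‖w x‖ ^ 2 / ρ x := by
        have := hΛ0 x
        positivity
      calc ⟪fderiv ℝ β x (w x), w x⟫ / ρ x * χ x ≤ Λs x * ‖w x‖ ^ 2 / ρ x * χ x := h1
        _ ≤ Λs x * ‖w x‖ * 1 := mul_le_mul h2 (hχ1 x) (hχ0 x) (le_trans h3 h2)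
        _ = Λs x * ‖w x‖ := mul_one _
    have hk : ⟪w x, (Δ w) x⟫ / ρ x * χ x ≤ (Δ g) x * χ x :=
      mul_le_mul_of_nonneg_right (hΔg x) (hχ0 x)
    have e : -(⟪w x, (Δ w) x⟫ + ⟪w x, fderiv ℝ w x (β x)⟫ + ⟪fderiv ℝ β x (w x), w x⟫) / ρ x * χ x
        = -(⟪w x, (Δ w) x⟫ / ρ x * χ x) - χ x * (⟪w x, fderiv ℝ w x (β x)⟫ / ρ x)
          - ⟪fderiv ℝ β x (w x), w x⟫ / ρ x * χ x := by ring
    rw [e]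
    linarith
  -- continuity facts
  have hDw : Continuous (fderiv ℝ w) := hw.continuous_fderiv two_ne_zero
  have hΔw : Continuous (Δ w) := continuous_laplacian hw
  have hadj : Continuous fun x => ContinuousLinearMap.adjoint (fderiv ℝ β x) (w x) :=
    clockMass_continuous_adjoint_apply hw.continuous hβ
  have hρc : Continuous ρ := hρ2.continuous
  -- integrability (continuous with compact support)
  have hI_rhs : Integrable (fun x => ⟪w x, -((Δ w) x + fderiv ℝ w x (β x) +
      ContinuousLinearMap.adjoint (fderiv ℝ β x) (w x))⟫ / absApprox δ ‖w x‖ * χ x) := by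
    have eρ : (fun x => absApprox δ ‖w x‖) = ρ := hρdef.symm
    have hc : Continuous fun x => ⟪w x, -((Δ w) x + fderiv ℝ w x (β x) +
        ContinuousLinearMap.adjoint (fderiv ℝ β x) (w x))⟫ / absApprox δ ‖w x‖ * χ x := by
      refine (Continuous.div (hw.continuous.inner ((hΔw.add (hDw.clm_apply hβ.continuous)).add
        hadj).neg) ?_ fun x => ?_).mul hχ.continuous
      · rw [eρ]; exact hρc
      · exact (absApprox_pos hδ _).ne'
    exact hc.integrable_of_hasCompactSupport hχc.mul_left
  have hI_a : Integrable (fun x => χ x * fderiv ℝ g x (β x)) :=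
    (hχ.continuous.mul ((hg2.continuous_fderiv two_ne_zero).clm_apply hβ.continuous))
      |>.integrable_of_hasCompactSupport hχc.mul_right
  have hI_b : Integrable (fun x => χ x * (Δ g) x) :=
    (hχ.continuous.mul (continuous_laplacian hg2)).integrable_of_hasCompactSupport hχc.mul_right
  have hDχc : HasCompactSupport (fun x => fderiv ℝ χ x (β x)) :=
    (hχc.fderiv (𝕜 := ℝ)).mono fun x hx => by
      rw [mem_support] at hx ⊢
      contrapose! hx
      simp [hx]
  have hΔχc : HasCompactSupport (Δ χ) :=
    HasCompactSupport.intro hχc fun x hx => laplacian_eq_zero_of_notMem_tsupport hx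
  have hI_a' : Integrable (fun x => fderiv ℝ χ x (β x) * g x) :=
    (((hχ.continuous_fderiv two_ne_zero).clm_apply hβ.continuous).mul hg2.continuous)
      |>.integrable_of_hasCompactSupport hDχc.mul_right
  have hI_b' : Integrable (fun x => (Δ χ) x * g x) :=
    ((continuous_laplacian hχ).mul hg2.continuous).integrable_of_hasCompactSupport hΔχc.mul_right
  -- integration by parts
  have hibp1 : ∫ x, χ x * fderiv ℝ g x (β x) = -∫ x, fderiv ℝ χ x (β x) * g x :=
    kernelCalculus_integral_mul_fderiv_apply (hχ.of_le one_le_two) hχc (hg2.of_le one_le_two)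
      hβ hdiv
  have hibp2 : ∫ x, χ x * (Δ g) x = ∫ x, (Δ χ) x * g x :=
    kernelCalculus_integral_mul_laplacian hχ hχc hg2
  -- the boundary integrand is `O(1/R) ‖w‖`
  have hB0 : 0 ≤ B := (norm_nonneg _).trans (hB 0)
  have hK0 : 0 ≤ (B * C₁ + C₂) / R := div_nonneg (add_nonneg (mul_nonneg hB0 hC₁0) hC₂0) hR0.le
  have hK : ∀ x, |(fderiv ℝ χ x (β x) - (Δ χ) x) * g x| ≤ (B * C₁ + C₂) / R * ‖w x‖ := by
    intro x
    rw [abs_mul]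
    have h1 : |fderiv ℝ χ x (β x)| ≤ C₁ / R * B := by
      rw [← Real.norm_eq_abs]
      calc ‖fderiv ℝ χ x (β x)‖ ≤ ‖fderiv ℝ χ x‖ * ‖β x‖ := ContinuousLinearMap.le_opNorm _ _
        _ ≤ C₁ / R * B :=
          mul_le_mul (hχdef ▸ hC₁ x) (hB x) (norm_nonneg _) (div_nonneg hC₁0 hR0.le)
    have h2 : |(Δ χ) x| ≤ C₂ / R := by
      refine (hχdef ▸ hC₂ x).trans ?_
      exact div_le_div_of_nonneg_left hC₂0 hR0 (by nlinarith)
    have h3 : |fderiv ℝ χ x (β x) - (Δ χ) x| ≤ (B * C₁ + C₂) / R :=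
      calc _ ≤ |fderiv ℝ χ x (β x)| + |(Δ χ) x| := abs_sub _ _
        _ ≤ C₁ / R * B + C₂ / R := add_le_add h1 h2
        _ = (B * C₁ + C₂) / R := by ring
    exact mul_le_mul h3 (hg_le x) (abs_nonneg _) hK0
  have hI_K : Integrable (fun x => (fderiv ℝ χ x (β x) - (Δ χ) x) * g x) := by
    have : (fun x => (fderiv ℝ χ x (β x) - (Δ χ) x) * g x) =
        fun x => fderiv ℝ χ x (β x) * g x - (Δ χ) x * g x := by
      funext x; ring
    rw [this]
    exact hI_a'.sub hI_b'
  have hI_an : Integrable (fun x => -(χ x * (Δ g) x)) := hI_b.neg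
  -- the chain of (in)equalities
  have s1 : -((B * C₁ + C₂) / R * ∫ x, ‖w x‖) = ∫ x, -((B * C₁ + C₂) / R * ‖w x‖) := by
    rw [integral_neg, integral_const_mul]
  have s2 : ∫ x, -((B * C₁ + C₂) / R * ‖w x‖) ≤ ∫ x, (fderiv ℝ χ x (β x) - (Δ χ) x) * g x :=
    integral_mono ((hwi.norm.const_mul _).neg) hI_K fun x => neg_le_of_abs_le (hK x)
  have s3 : ∫ x, (fderiv ℝ χ x (β x) - (Δ χ) x) * g x =
      (∫ x, fderiv ℝ χ x (β x) * g x) - ∫ x, (Δ χ) x * g x := by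
    rw [← integral_sub hI_a' hI_b']
    exact integral_congr_ae (Eventually.of_forall fun x => by ring)
  have s4 : (∫ x, fderiv ℝ χ x (β x) * g x) - (∫ x, (Δ χ) x * g x) - ∫ x, Λs x * ‖w x‖ =
      ∫ x, (-(χ x * (Δ g) x) - χ x * fderiv ℝ g x (β x) - Λs x * ‖w x‖) := by
    have hAB : Integrable (fun x => -(χ x * (Δ g) x) - χ x * fderiv ℝ g x (β x)) := hI_an.sub hI_a
    rw [integral_sub hAB hΛi, integral_sub hI_an hI_a, integral_neg, hibp1, hibp2]
    ring
  have s5 : ∫ x, (-(χ x * (Δ g) x) - χ x * fderiv ℝ g x (β x) - Λs x * ‖w x‖) ≤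
      ∫ x, ⟪w x, -((Δ w) x + fderiv ℝ w x (β x) +
          ContinuousLinearMap.adjoint (fderiv ℝ β x) (w x))⟫ / absApprox δ ‖w x‖ * χ x :=
    have hABC : Integrable (fun x => -(χ x * (Δ g) x) - χ x * fderiv ℝ g x (β x) - Λs x * ‖w x‖) :=
      (hI_an.sub hI_a).sub hΛi
    integral_mono hABC hI_rhs hpt
  rw [s1, ← hχdef]
  linarith

end Slice

/-! ### Removal of the cut-off and of the regularisation -/

/-- **Removal of the cut-off and of the regularisation** (dominated convergence): for `w`
continuous and integrable, `∫ (ρ_{1/(n+1)}(w) − 1/(n+1)) χ_{n+1} → ∫ ‖w‖`. [folklore] -/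
theorem clockMass_tendsto_cutoffIntegral {w : EuclideanSpace ℝ (Fin 3) → EuclideanSpace ℝ (Fin 3)}
    (hw : Continuous w) (hwi : Integrable w) :
    Tendsto (fun n : ℕ => ∫ x, (absApprox (1 / ((n : ℝ) + 1)) ‖w x‖ - 1 / ((n : ℝ) + 1)) *
      cutoff ((n : ℝ) + 1) x) atTop (𝓝 (∫ x, ‖w x‖)) := by
  refine tendsto_integral_of_dominated_convergence (fun x => ‖w x‖) (fun n => ?_) hwi.norm
    (fun n => Eventually.of_forall fun x => ?_) (Eventually.of_forall fun x => ?_)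
  · have hδ : (0 : ℝ) < 1 / ((n : ℝ) + 1) := by positivity
    exact ((((contDiff_absApprox hδ (n := 0)).continuous.comp hw.norm).sub continuous_const).mul
      (contDiff_cutoff (n := 0) _).continuous).aestronglyMeasurable
  · have hδ : (0 : ℝ) < 1 / ((n : ℝ) + 1) := by positivity
    rw [Real.norm_eq_abs, abs_mul]
    calc |absApprox (1 / ((n : ℝ) + 1)) ‖w x‖ - 1 / ((n : ℝ) + 1)| * |cutoff ((n : ℝ) + 1) x|
        ≤ ‖w x‖ * 1 :=
          mul_le_mul (clockMass_abs_rho_sub_le hδ w x) (abs_cutoff_le_one _ _) (abs_nonneg _)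
            (norm_nonneg _)
      _ = ‖w x‖ := mul_one _
  · have := ((tendsto_absApprox ‖w x‖).sub tendsto_one_div_add_atTop_nhds_zero_nat).mul
      (tendsto_cutoff_natCast_add_one x)
    simpa using this

end Summit.NavierStokesRegularity.NavierStokesRegularity.Theorems

end
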